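import Mathlib
import Summits.ValiantsHypothesis.ValiantsHypothesis.Theorems.BinomialElusiveBinomialCandidateJetReductionIteration

/-!
# Crux `BinomialElusive.BinomialCandidate` (stmt-ValiantsHypothesis-7392), line `registered` —
# stub `stub_crossCap`, piece 3: elimination of the regular coordinates (Picard iteration)

Corank-one data in normal form: source variables `Y_0 = x` (the kernel direction) and
`Y_1, …, Y_{n₀}` (regular), target variables `W_0, W_1` (special) and `W_2, …, W_{n₀+1}`
(regular, `W_{j+1} ↔ Y_j`), polynomials `B_i(Y)` without monomials of degree `< 2`, and
Laurent series `q_j(t)`, `T_i(t)` of positive order with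

* `q_j + B_{j+1}(q) = T_{j+1}` for the regular indices `j = 1, …, n₀`,
* `B_0(q) = T_0`, `B_1(q) = T_1`.

`crossCap_iteration`: for every `G` there are polynomials `F₀, F₁ ∈ ℂ[W][X]` with
`F_a(T(t), q_0(t)) ≡ 0 (mod t^G)` whose low coefficients are explicit: writing
`F_a = Σ_j f_{a,j}(W) X^j`, `f_{a,0}` and `f_{a,1}` have zero constant term, `f_{a,2}(0)` is the
coefficient of `Y_0²` in `B_a`, and the coefficient of `W_b` in `f_{a,0}` is `-δ_{ab}`
(`a, b ∈ {0, 1}`).  Construction: `F_a := B_a(Φ_G(W', X)) - W_a`, where `Φ_G` is the `G`-th Picard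
iterate of `Y ↦ W' - B'(Y)` (`jetReduction` machinery of the immersive case, imported:
`JetReduction.filt_sub_aeval_iter` is CLAIM A, `JetReduction.iter_sub_X` controls the 2-jet) and
`W'` substitutes `W_{j+1}` for `Y_j` (`j ≥ 1`) and keeps `X = Y_0` (`MvPolynomial.finSuccEquiv`
followed by renaming).
-/

-- layout Summits/ValiantsHypothesis/ValiantsHypothesis forces the duplicated namespace component
set_option linter.dupNamespace false

noncomputable section

namespace Summit.ValiantsHypothesis.ValiantsHypothesis.Theorems.BinomialCandidateStubs

open scoped BigOperators
open MvPolynomial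

namespace CrossCap

variable {n₀ : ℕ}

/-! ## The embedding `ℂ[Y_0, …, Y_{n₀}] → ℂ[W_0, …, W_{n₀+1}][X]`, `Y_0 ↦ X`, `Y_j ↦ W_{j+1}` -/

/-- Evaluating the embedded polynomial at `W := T`, `X := x` is evaluating the original
polynomial at `(x, T_2, …, T_{n₀+1})`. -/
theorem eval₂_embed (T : Fin (n₀ + 2) → LaurentSeries ℂ) (x : LaurentSeries ℂ)
    (G : MvPolynomial (Fin (n₀ + 1)) ℂ) :
    Polynomial.eval₂ (MvPolynomial.aeval T).toRingHom x
      (Polynomial.map (MvPolynomial.rename (fun j' : Fin n₀ => j'.succ.succ)).toRingHom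
        (MvPolynomial.finSuccEquiv ℂ n₀ G)) =
    MvPolynomial.aeval (Fin.cons x (fun j' : Fin n₀ => T j'.succ.succ)) G := by
  set Ψ : MvPolynomial (Fin (n₀ + 1)) ℂ →ₐ[ℂ] LaurentSeries ℂ :=
    (Polynomial.eval₂AlgHom (MvPolynomial.aeval T) x (fun a => Commute.all _ _)).comp
      ((Polynomial.mapAlgHom (MvPolynomial.rename (fun j' : Fin n₀ => j'.succ.succ))).comp
        (MvPolynomial.finSuccEquiv ℂ n₀).toAlgHom) with hΨ
  have h1 : Ψ = MvPolynomial.aeval (Fin.cons x (fun j' : Fin n₀ => T j'.succ.succ)) := by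
    refine MvPolynomial.algHom_ext fun i => ?_
    refine Fin.cases ?_ (fun j' => ?_) i
    · simp [hΨ, Polynomial.coe_mapAlgHom, MvPolynomial.finSuccEquiv_X_zero]
    · simp [hΨ, Polynomial.coe_mapAlgHom, MvPolynomial.finSuccEquiv_X_succ]
  have := congrArg (fun φ => φ G) h1
  simpa [hΨ, Polynomial.coe_mapAlgHom] using this

/-- Coefficients of the embedded polynomial: the constant term (in `W`) of the `X^j`-coefficient
is the coefficient of `Y_0^j`. -/
theorem constantCoeff_coeff_embed (G : MvPolynomial (Fin (n₀ + 1)) ℂ) (j : ℕ) :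
    MvPolynomial.constantCoeff ((Polynomial.map
      (MvPolynomial.rename (fun j' : Fin n₀ => j'.succ.succ)).toRingHom
        (MvPolynomial.finSuccEquiv ℂ n₀ G)).coeff j) =
      MvPolynomial.coeff (Finsupp.single 0 j) G := by
  rw [Polynomial.coeff_map, AlgHom.toRingHom_eq_coe, RingHom.coe_coe,
    MvPolynomial.constantCoeff_rename, MvPolynomial.constantCoeff_eq,
    MvPolynomial.finSuccEquiv_coeff_coeff]
  congr 1
  ext l
  refine Fin.cases ?_ (fun i => ?_) l
  · simp
  · simp [Finsupp.cons_succ, Fin.succ_ne_zero]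

/-- Coefficients of the embedded polynomial: no coefficient involves `W_0` or `W_1` linearly. -/
theorem coeff_single_coeff_embed (G : MvPolynomial (Fin (n₀ + 1)) ℂ) (j : ℕ) (b : Fin (n₀ + 2))
    (hb : ∀ j' : Fin n₀, j'.succ.succ ≠ b) :
    MvPolynomial.coeff (Finsupp.single b 1) ((Polynomial.map
      (MvPolynomial.rename (fun j' : Fin n₀ => j'.succ.succ)).toRingHom
        (MvPolynomial.finSuccEquiv ℂ n₀ G)).coeff j) = 0 := by
  classical
  rw [Polynomial.coeff_map, AlgHom.toRingHom_eq_coe, RingHom.coe_coe]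
  refine MvPolynomial.coeff_rename_eq_zero _ _ _ fun u hu => ?_
  exfalso
  have hmem : b ∈ (Finsupp.mapDomain (fun j' : Fin n₀ => j'.succ.succ) u).support := by
    rw [hu]; simp
  obtain ⟨j', -, hj'⟩ := Finset.mem_image.mp (Finsupp.mapDomain_support hmem)
  exact hb j' hj'

/-- `W_0 ≠ W_{j+2}` and `W_1 ≠ W_{j+2}`. -/
theorem succ_succ_ne (j' : Fin n₀) (b : Fin (n₀ + 2)) (hb : b = 0 ∨ b = 1) : j'.succ.succ ≠ b := by
  rcases hb with rfl | rfl
  · exact Fin.succ_ne_zero _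
  · rw [← Fin.succ_zero_eq_one, Ne, Fin.succ_inj]
    exact Fin.succ_ne_zero _

end CrossCap

open CrossCap in
/-- **Elimination of the regular coordinates** (piece 3 of the stub `stub_crossCap`).  In the
corank-one normal form (`B_i` without monomials of degree `< 2`; `q`, `T` of positive order;
`q_j + B_{j+1}(q) = T_{j+1}` for the regular indices, `B_0(q) = T_0`, `B_1(q) = T_1`), for every
`G` there are `F₀, F₁ ∈ ℂ[W][X]` with `F_a(T, q_0) ≡ 0 (mod t^G)`, `f_{a,0}(0) = f_{a,1}(0) = 0`,
`f_{a,2}(0) = coeff_{Y_0²} B_a`, and `coeff_{W_b} f_{a,0} = -δ_{ab}` (`a, b ∈ {0,1}`). -/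
theorem crossCap_iteration :
    ∀ (n₀ G : ℕ) (B : Fin (n₀ + 2) → MvPolynomial (Fin (n₀ + 1)) ℂ)
      (q : Fin (n₀ + 1) → LaurentSeries ℂ) (T : Fin (n₀ + 2) → LaurentSeries ℂ),
      (∀ i, ∀ d : Fin (n₀ + 1) →₀ ℕ, d.degree < 2 → MvPolynomial.coeff d (B i) = 0) →
      (∀ j, ∀ g : ℤ, g < 1 → (q j).coeff g = 0) →
      (∀ i, ∀ g : ℤ, g < 1 → (T i).coeff g = 0) →
      (∀ j' : Fin n₀, q j'.succ + MvPolynomial.aeval q (B j'.succ.succ) = T j'.succ.succ) →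
      MvPolynomial.aeval q (B 0) = T 0 →
      MvPolynomial.aeval q (B 1) = T 1 →
      ∃ F₀ F₁ : Polynomial (MvPolynomial (Fin (n₀ + 2)) ℂ),
        (∀ g : ℤ, g < G →
          (Polynomial.eval₂ (MvPolynomial.aeval T).toRingHom (q 0) F₀).coeff g = 0) ∧
        (∀ g : ℤ, g < G →
          (Polynomial.eval₂ (MvPolynomial.aeval T).toRingHom (q 0) F₁).coeff g = 0) ∧
        MvPolynomial.constantCoeff (F₀.coeff 0) = 0 ∧
        MvPolynomial.constantCoeff (F₀.coeff 1) = 0 ∧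
        MvPolynomial.constantCoeff (F₀.coeff 2) = MvPolynomial.coeff (Finsupp.single 0 2) (B 0) ∧
        MvPolynomial.constantCoeff (F₁.coeff 0) = 0 ∧
        MvPolynomial.constantCoeff (F₁.coeff 1) = 0 ∧
        MvPolynomial.constantCoeff (F₁.coeff 2) = MvPolynomial.coeff (Finsupp.single 0 2) (B 1) ∧
        MvPolynomial.coeff (Finsupp.single 0 1) (F₀.coeff 0) = -1 ∧
        MvPolynomial.coeff (Finsupp.single 1 1) (F₀.coeff 0) = 0 ∧
        MvPolynomial.coeff (Finsupp.single 0 1) (F₁.coeff 0) = 0 ∧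
        MvPolynomial.coeff (Finsupp.single 1 1) (F₁.coeff 0) = -1 := by
  intro n₀ G B q T hB hq hT hreg h0 h1
  -- the `t`-adic filtration of `ℂ((t))`
  have hF := JetReduction.laurentGE_isFilt
  set F : ℕ → LaurentSeries ℂ → Prop := fun m z => ∀ g : ℤ, g < m → z.coeff g = 0 with hFdef
  -- the fixed-point system `q_j = W_j - B'_j(q)` on all `n₀ + 1` source variables
  set Bs : Fin (n₀ + 1) → MvPolynomial (Fin (n₀ + 1)) ℂ := Fin.cons 0 (fun j' => B j'.succ.succ)
    with hBs_def
  set W : Fin (n₀ + 1) → LaurentSeries ℂ := Fin.cons (q 0) (fun j' => T j'.succ.succ) with hW_def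
  have hBs : ∀ j, ∀ d : Fin (n₀ + 1) →₀ ℕ, d.degree < 2 → coeff d (Bs j) = 0 :=
    Fin.cases (fun d _ => by simp [hBs_def]) (fun j' => by simpa [hBs_def] using hB j'.succ.succ)
  have hq' : ∀ j, F 1 (q j) := fun j g hg => hq j g (by exact_mod_cast hg)
  have hT' : ∀ i, F 1 (T i) := fun i g hg => hT i g (by exact_mod_cast hg)
  have hW : ∀ j, F 1 (W j) :=
    Fin.cases (by simpa [hW_def] using hq' 0) (fun j' => by simpa [hW_def] using hT' j'.succ.succ)
  have hfix : ∀ j, q j = W j - aeval q (Bs j) :=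
    Fin.cases (by simp [hW_def, hBs_def]) (fun j' => by
      simp only [hW_def, hBs_def, Fin.cons_succ]
      rw [← hreg j']
      ring)
  -- the Picard iterates
  set Φ : ℕ → Fin (n₀ + 1) → MvPolynomial (Fin (n₀ + 1)) ℂ :=
    fun m => (fun (Ψ : Fin (n₀ + 1) → MvPolynomial (Fin (n₀ + 1)) ℂ) (j : Fin (n₀ + 1)) =>
      X j - aeval Ψ (Bs j))^[m] X with hΦdef
  have hΦ0 : ∀ j, Φ 0 j = X j := fun j => rfl
  have hΦ : ∀ m j, Φ (m + 1) j = X j - aeval (Φ m) (Bs j) := fun m j => by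
    simp only [hΦdef, Function.iterate_succ_apply']
  -- CLAIM A: `q ≡ Φ_m(W)` to level `m + 2`
  have hA : ∀ m j, F (m + 2) (q j - aeval W (Φ m j)) :=
    JetReduction.filt_sub_aeval_iter hF hBs hΦ0 hΦ hq' hW hfix
  -- the polynomials `B_a(Φ_G)` and their 2-jets
  set Gp : Fin (n₀ + 2) → MvPolynomial (Fin (n₀ + 1)) ℂ := fun a => aeval (Φ G) (B a) with hGp_def
  have hGp2 : ∀ a, ∀ d : Fin (n₀ + 1) →₀ ℕ, d.degree < 2 → coeff d (Gp a) = 0 := fun a =>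
    JetReduction.aeval_degGE (hB a) (JetReduction.iter_degGE_one hBs hΦ0 hΦ G)
  have hcoef2 : ∀ a, coeff (Finsupp.single 0 2) (Gp a) = coeff (Finsupp.single 0 2) (B a) := by
    intro a
    have h := JetReduction.aeval_sub_aeval_degGE (t := 1) (hB a)
      (JetReduction.iter_degGE_one hBs hΦ0 hΦ G) (fun i => JetReduction.degGE_X i)
      (fun i => JetReduction.iter_sub_X hBs hΦ0 hΦ G i) (Finsupp.single 0 2) (by simp)
    rwa [aeval_X_left, AlgHom.id_apply, coeff_sub, sub_eq_zero] at h
  -- CLAIM B: `B_a(Φ_G(W)) ≡ B_a(q)` to level `G + 3`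
  have hBval : ∀ a, F (G + 1 + 2) (aeval W (Gp a) - aeval q (B a)) := by
    intro a
    rw [hGp_def, JetReduction.aeval_aeval]
    exact JetReduction.filt_aeval_sub_aeval hF (hB a)
      (fun j => JetReduction.filt_aeval_iter hF hBs hΦ0 hΦ hW G j) hq' (G + 1)
      (fun j => by
        have h := hF.2.2.1 (G + 2) _ (hA G j)
        rw [neg_sub] at h
        exact h)
  -- the polynomials `F_a`
  have hev : ∀ a, aeval q (B a) = T a →
      ∀ g : ℤ, g < G → (Polynomial.eval₂ (MvPolynomial.aeval T).toRingHom (q 0)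
        (Polynomial.map (MvPolynomial.rename (fun j' : Fin n₀ => j'.succ.succ)).toRingHom
          (MvPolynomial.finSuccEquiv ℂ n₀ (Gp a)) - Polynomial.C (X a))).coeff g = 0 := by
    intro a ha g hg
    rw [Polynomial.eval₂_sub, eval₂_embed, Polynomial.eval₂_C]
    have := hBval a g (by push_cast; omega)
    simpa [ha, hW_def] using this
  have hcc : ∀ a (j : ℕ), MvPolynomial.constantCoeff
      ((Polynomial.map (MvPolynomial.rename (fun j' : Fin n₀ => j'.succ.succ)).toRingHom
        (MvPolynomial.finSuccEquiv ℂ n₀ (Gp a)) - Polynomial.C (X a)).coeff j) =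
      coeff (Finsupp.single 0 j) (Gp a) := by
    intro a j
    rw [Polynomial.coeff_sub, map_sub, constantCoeff_coeff_embed, Polynomial.coeff_C]
    split_ifs <;> simp
  have hlin : ∀ a b : Fin (n₀ + 2), b = 0 ∨ b = 1 → MvPolynomial.coeff (Finsupp.single b 1)
      ((Polynomial.map (MvPolynomial.rename (fun j' : Fin n₀ => j'.succ.succ)).toRingHom
        (MvPolynomial.finSuccEquiv ℂ n₀ (Gp a)) - Polynomial.C (X a)).coeff 0) =
      if a = b then -1 else 0 := by
    intro a b hb
    classical
    rw [Polynomial.coeff_sub, coeff_sub, coeff_single_coeff_embed _ _ _ (fun j' => succ_succ_ne j' b hb),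
      Polynomial.coeff_C_zero, coeff_X, zero_sub]
    by_cases hab : a = b
    · subst hab; simp
    · rw [if_neg (fun h => hab (Finsupp.single_left_injective one_ne_zero h)), if_neg hab, neg_zero]
  refine ⟨_, _, hev 0 h0, hev 1 h1, ?_, ?_, ?_, ?_, ?_, ?_, ?_, ?_, ?_, ?_⟩
  · rw [hcc, Finsupp.single_zero]; exact hGp2 0 0 (by simp)
  · rw [hcc]; exact hGp2 0 _ (by simp)
  · rw [hcc, hcoef2]
  · rw [hcc, Finsupp.single_zero]; exact hGp2 1 0 (by simp)
  · rw [hcc]; exact hGp2 1 _ (by simp)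
  · rw [hcc, hcoef2]
  · rw [hlin 0 0 (Or.inl rfl), if_pos rfl]
  · rw [hlin 0 1 (Or.inr rfl), if_neg Fin.zero_ne_one]
  · rw [hlin 1 0 (Or.inl rfl), if_neg Fin.zero_ne_one.symm]
  · rw [hlin 1 1 (Or.inr rfl), if_pos rfl]

end Summit.ValiantsHypothesis.ValiantsHypothesis.Theorems.BinomialCandidateStubs

end
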